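import Summits.KontsevichZagierPeriods.KontsevichZagierPeriods.Theorems.HurwitzMicroSectorsDilationMove
import Summits.KontsevichZagierPeriods.KontsevichZagierPeriods.Theorems.HurwitzMicroSectorsNormalFormPrincipleLevelOneExistsRep
import Literature.NumberTheory.Transcendental.KZLogCalculusProofs

/-!
# `NormalFormPrinciple` (stmt-KontsevichZagierPeriods-3869), line `SketchIdeator1` —
# the leaf `stub_boxRigidity` in dimension two, level two: the odd diagonal carrier

Pure proof file (stub `diagOdd_levelTwo_sub_mem_relations` of the dimension-two, level-two layer,
lead seat c7; `--supports` the crux). Write `t = x₀x₁` on the open unit box `(0,1)²`. The odd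
diagonal carrier `[(0,1)², c·t/(1 − t²)]` (value `c·π²/24`) and the level-two kernel representation
`[(0,1)², (c/3)/(1 − t²)]` (value `(c/3)·π²/8`) differ by a relation of the tree's Kontsevich–Zagier
calculus. This is the Hurwitz distribution relation `H₀ + H₁ ∼ 4H₁` of level two, realised INSIDE
the calculus by three moves:

1. (rule 2, the dilation `(x₀, x₁) ↦ (x₀², x₁²)`, i.e. the landed crux `DilationMove_of` with
   `n = m = 2`, Jacobian `4x₀x₁`) `[(0,1)², (4c/3)·t/(1 − t²)] − [(0,1)², (c/3)/(1 − t)]` is one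
   change-of-variables generator, since `(c/3)/(1 − x₀²x₁²) · 4x₀x₁ = (4c/3)·t/(1 − t²)`;
2. (rule 1b) `(c/3)/(1 − t) = (c/3)/(1 − t²) + (c/3)·t/(1 − t²)` (`1 − t² = (1 − t)(1 + t)`);
3. (rule 1b) `(4c/3)·t/(1 − t²) = c·t/(1 − t²) + (c/3)·t/(1 − t²)`;

and `[Nr] − [B] = (2) − (3) + (1)` in the formal group. The two auxiliary representations
`[(0,1)², k·t/(1 − t²)]` (`k = 4c/3`, `c/3`) are constructed here (semialgebraic rational integrand
with denominator `1 − t² > 0` on the box; integrable by domination `k·t/(1 − t²) ≤ |k|/(1 − t)` from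
Beukers' kernel `box_integral_one_div_one_sub_mul_two`); the level-one representation
`[(0,1)², (c/3)/(1 − t)]` is `LevelOne.exists_levelOneRep (C (c/3))`.

Sources: M. Kontsevich, D. Zagier, *Periods* (2001), §1.2 rules (1), (2); J. Milnor, *On
polylogarithms, Hurwitz zeta functions, and the Kubert identities* (1983), §1 (distribution
relations). No definitions are introduced.
-/

noncomputable section

open MeasureTheory Set
open Literature.NumberTheory.Transcendental Literature.NumberTheory.Transcendental.KZ
open Literature.ModelTheory.ExponentialFields (IsSemialgebraic)

namespace Summit.KontsevichZagierPeriods.HurwitzMicroSectors.NormalFormPrinciple.PiBox.LevelN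

/-! ## The odd diagonal carrier `[(0,1)², k·x₀x₁/(1 − (x₀x₁)²)]` -/

/-- On the open unit box of `ℝ²` the product coordinate `t = x₀x₁` lies in `(0,1)`. [folklore] -/
theorem diagOdd_mul_mem_Ioo {x : Fin 2 → ℝ} (hx : ∀ i, x i ∈ Set.Ioo (0:ℝ) 1) :
    0 < x 0 * x 1 ∧ x 0 * x 1 < 1 :=
  ⟨mul_pos (hx 0).1 (hx 1).1,
    mul_lt_one_of_nonneg_of_lt_one_left (hx 0).1.le (hx 0).2 (hx 1).2.le⟩

/-- On the open unit box of `ℝ²` the level-two denominator `1 − (x₀x₁)²` is positive. [folklore] -/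
theorem diagOdd_one_sub_sq_pos {x : Fin 2 → ℝ} (hx : ∀ i, x i ∈ Set.Ioo (0:ℝ) 1) :
    0 < 1 - (x 0 * x 1) ^ 2 :=
  sub_pos.2 (pow_lt_one₀ (diagOdd_mul_mem_Ioo hx).1.le (diagOdd_mul_mem_Ioo hx).2 two_ne_zero)

/-- **Semialgebraicity of the odd diagonal carrier.** For `k ∈ ℚ`, `x ↦ k·x₀x₁/(1 − (x₀x₁)²)` is a
`ℚ`-semialgebraic function on the open unit box (a quotient of `ℚ`-polynomials whose denominator
`1 − (x₀x₁)²` is positive there). [cite: KontsevichZagier2001, §1.1] -/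
theorem isSemialgebraicFunOn_diagOdd (k : ℚ) :
    IsSemialgebraicFunOn ℚ {x : Fin 2 → ℝ | ∀ i, x i ∈ Set.Ioo (0:ℝ) 1}
      (fun x => (k : ℝ) * (x 0 * x 1) / (1 - (x 0 * x 1) ^ 2)) := by
  refine (isSemialgebraicFunOn_aeval_div_aeval (isSemialgebraic_box 2)
    (MvPolynomial.C k * (MvPolynomial.X 0 * MvPolynomial.X 1))
    (1 - (MvPolynomial.X 0 * MvPolynomial.X 1) ^ 2) fun x hx => ?_).congr fun x _ => by simp
  simp only [map_sub, map_one, map_mul, map_pow, MvPolynomial.aeval_X]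
  exact (diagOdd_one_sub_sq_pos hx).ne'

/-- **Absolute convergence of the odd diagonal carrier.** For `k ∈ ℚ`, `k·x₀x₁/(1 − (x₀x₁)²)` is
integrable on the open unit box, by domination: with `t = x₀x₁ ∈ (0,1)`,
`|k·t/(1 − t²)| = |k|·t/((1 − t)(1 + t)) ≤ |k|/(1 − t)`, and `1/(1 − x₀x₁)` is integrable on the box
(Beukers' double integral for `ζ(2)`, `box_integral_one_div_one_sub_mul_two`). [folklore] -/
theorem integrableOn_diagOdd (k : ℚ) :
    IntegrableOn (fun x : Fin 2 → ℝ => (k : ℝ) * (x 0 * x 1) / (1 - (x 0 * x 1) ^ 2))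
      {x | ∀ i, x i ∈ Set.Ioo (0:ℝ) 1} := by
  have hA : MeasurableSet {x : Fin 2 → ℝ | ∀ i, x i ∈ Set.Ioo (0:ℝ) 1} :=
    IsSemialgebraic.measurableSet_holds (isSemialgebraic_box 2)
  refine Integrable.mono (box_integral_one_div_one_sub_mul_two.1.const_mul |(k : ℝ)|)
    (Measurable.aestronglyMeasurable (by fun_prop)) (ae_restrict_of_forall_mem hA fun x hx => ?_)
  obtain ⟨ht0, ht1⟩ := diagOdd_mul_mem_Ioo hx
  have hd1 : 0 < 1 - x 0 * x 1 := sub_pos.2 ht1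
  have hd2 : 0 < 1 - (x 0 * x 1) ^ 2 := diagOdd_one_sub_sq_pos hx
  rw [Real.norm_eq_abs, Real.norm_eq_abs, abs_div, abs_mul, abs_of_pos ht0, abs_of_pos hd2,
    abs_of_nonneg (by positivity : (0:ℝ) ≤ |(k : ℝ)| * (1 / (1 - x 0 * x 1))), mul_div_assoc]
  refine mul_le_mul_of_nonneg_left ?_ (abs_nonneg _)
  rw [div_le_div_iff₀ hd2 hd1, one_mul]
  nlinarith

/-- **Existence of the odd diagonal carrier.** For `k ∈ ℚ` there is an integral representation of
dimension `2` with domain the open unit box `(0,1)²` and integrand `x ↦ k·x₀x₁/(1 − (x₀x₁)²)`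
(value `k·π²/24`). [cite: KontsevichZagier2001, §1.1] -/
theorem exists_diagOddRep (k : ℚ) :
    ∃ R : IntegralRep 2, R.domain = {x | ∀ i, x i ∈ Set.Ioo (0:ℝ) 1} ∧
      R.integrand = fun x => (k : ℝ) * (x 0 * x 1) / (1 - (x 0 * x 1) ^ 2) :=
  ⟨⟨_, _, isSemialgebraic_box 2, isSemialgebraicFunOn_diagOdd k, integrableOn_diagOdd k⟩, rfl, rfl⟩

/-- The partial-fraction identity behind rule (1b) at level two:
`K/(1 − t) = K/(1 − t²) + K·t/(1 − t²)` whenever `1 − t ≠ 0 ≠ 1 + t`. [folklore] -/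
theorem diagOdd_split_identity (K t : ℝ) (h1 : 1 - t ≠ 0) (h2 : 1 + t ≠ 0) :
    K / (1 - t) = K / (1 - t ^ 2) + K * t / (1 - t ^ 2) := by
  have h : (1 : ℝ) - t ^ 2 = (1 - t) * (1 + t) := by ring
  rw [h, ← add_div, div_eq_div_iff h1 (mul_ne_zero h1 h2)]
  ring

/-- **The odd diagonal carrier at level two** (registered sub-goal V6 of the level-two layer of
`stub_boxRigidity` in dimension two; the Hurwitz distribution relation `H₀ + H₁ ∼ 4H₁` inside the
calculus). With `t = x₀x₁` on the open unit box, `[(0,1)², c·t/(1 − t²)] − [(0,1)², (c/3)/(1 − t²)]`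
is a relation: the dilation `(x₀, x₁) ↦ (x₀², x₁²)` (`DilationMove_of`, `n = m = 2`, Jacobian
`4x₀x₁`) gives `[(4c/3)·t/(1 − t²)] − [(c/3)/(1 − t)] ∈ changeOfVariablesRel`; integrand additivity
gives `[(c/3)/(1 − t)] − [(c/3)/(1 − t²)] − [(c/3)·t/(1 − t²)] ∈ integrandAddRel` and
`[(4c/3)·t/(1 − t²)] − [c·t/(1 − t²)] − [(c/3)·t/(1 − t²)] ∈ integrandAddRel`; combine.
[cite: KontsevichZagier2001, §1.2 rules (1), (2)] -/
theorem diagOdd_levelTwo_sub_mem_relations (c : ℚ) (Nr B : IntegralRep 2)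
    (hNd : Nr.domain = {x | ∀ i, x i ∈ Set.Ioo (0:ℝ) 1})
    (hNi : EqOn Nr.integrand (fun x => (c : ℝ) * (x 0 * x 1) / (1 - (x 0 * x 1) ^ 2)) Nr.domain)
    (hBd : B.domain = {x | ∀ i, x i ∈ Set.Ioo (0:ℝ) 1})
    (hBi : EqOn B.integrand (fun x => ((c / 3 : ℚ) : ℝ) / (1 - (x 0 * x 1) ^ 2)) B.domain) :
    of Nr - of B ∈ relations := by
  -- the level-one representation `r' = [(0,1)², (c/3)/(1 − x₀x₁)]`
  obtain ⟨r', hr'd, hr'i⟩ := LevelOne.exists_levelOneRep (MvPolynomial.C (c / 3))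
  -- the odd diagonal carriers `r = [(0,1)², (4c/3)·t/(1 − t²)]`, `S = [(0,1)², (c/3)·t/(1 − t²)]`
  obtain ⟨r, hrd, hri⟩ := exists_diagOddRep (4 * (c / 3))
  obtain ⟨S, hSd, hSi⟩ := exists_diagOddRep (c / 3)
  -- (1) the dilation `(x₀, x₁) ↦ (x₀², x₁²)`
  have h1 : of r - of r' ∈ relations := by
    refine changeOfVariablesRel_subset_relations
      (Summit.KontsevichZagierPeriods.HurwitzMicroSectors.DilationMove.DilationMove_of 2 2
        (by norm_num) r r' hrd hr'd fun x hx => ?_)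
    rw [hrd] at hx
    have hD : (1 : ℝ) - x 0 ^ 2 * x 1 ^ 2 ≠ 0 := by
      rw [← mul_pow]
      exact (diagOdd_one_sub_sq_pos hx).ne'
    have hD' : (1 : ℝ) - (x 0 * x 1) ^ 2 ≠ 0 := (diagOdd_one_sub_sq_pos hx).ne'
    rw [hri, hr'i]
    simp only [Fin.prod_univ_two, MvPolynomial.aeval_C, eq_ratCast, Nat.add_one_sub_one, pow_one]
    push_cast
    field_simp
    ring
  -- (2) `(c/3)/(1 − t) = (c/3)/(1 − t²) + (c/3)·t/(1 − t²)` on the box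
  have h2 : of r' - of B - of S ∈ relations := by
    refine integrandAddRel_subset_relations ⟨2, r', B, S, by rw [hBd, hr'd], by rw [hSd, hr'd],
      fun x hx => ?_, rfl⟩
    rw [hr'd] at hx
    obtain ⟨ht0, ht1⟩ := diagOdd_mul_mem_Ioo hx
    rw [Pi.add_apply, hr'i, hBi (by rw [hBd]; exact hx), hSi]
    simp only [MvPolynomial.aeval_C, eq_ratCast]
    exact diagOdd_split_identity _ _ (sub_pos.2 ht1).ne' (by positivity)
  -- (3) `(4c/3)·t/(1 − t²) = c·t/(1 − t²) + (c/3)·t/(1 − t²)` on the box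
  have h3 : of r - of Nr - of S ∈ relations := by
    refine integrandAddRel_subset_relations ⟨2, r, Nr, S, by rw [hNd, hrd], by rw [hSd, hrd],
      fun x hx => ?_, rfl⟩
    rw [hrd] at hx
    rw [Pi.add_apply, hri, hNi (by rw [hNd]; exact hx), hSi]
    push_cast
    ring
  have e : of Nr - of B = (of r' - of B - of S) - (of r - of Nr - of S) + (of r - of r') := by
    abel
  rw [e]
  exact relations.add_mem (relations.sub_mem h2 h3) h1

end Summit.KontsevichZagierPeriods.HurwitzMicroSectors.NormalFormPrinciple.PiBox.LevelN

end
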